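import Summits.QuantumFields.GaugeBoot.SU3TraceIdentities
import HarnessLib

/-!
# The `3 × 3` pair identity (T1) behind the generators' `SU(3)` kinematical rows (cell `gauge-boot`, ENG-1 / F2, algebraic addendum)

Honest framing (cell rule): certified bounds on lattice expectations at stated coupling, gauge group, dimension and
torus size; NOT a mass gap, NOT a continuum limit, NOT a string tension; not summit-bearing
(`FixedCouplingUltralocality`, `PerturbativeInvisibility`).  This file is plain matrix algebra and carries no bound.

`SU3TraceIdentities.lean` proves Cayley–Hamilton for `3 × 3` matrices (`pow_three_eq_fin_three`) and the single-matrix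
reduction formulae.  The `SU(3)` loop-equation generators of this cell (G1 `leq/su3.py`, G2 `leq2`) and the kinematical
completeness audit of the `SU(3)` variable sets (KIN-CENSUS-G1 §H–§J; the "T1 tier") use ONE further pointwise identity,
the two-matrix PAIR IDENTITY

  `T1:  tr X⁻¹ · tr Y = tr (X⁻¹ Y) + tr X · tr (X Y) − tr (X² Y)`   (`det X = 1`),

whose instances inside a variable set are the derived equality rows filed as `kin_census/*_t1rows.json.gz`
(Newton's identity and the "modulus" identity are its `Y = X⁻¹` and `Y = X` cases).  T1 is Cayley–Hamilton multiplied by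
`X⁻¹ Y` and traced.  Proved here over any commutative ring (`[folklore]`):
* `adjugate_fin_three_eq` — `adj M = M² − (tr M)·M + symm₂(M)·1` for EVERY `3 × 3` matrix (no determinant condition);
* `trace_adjugate_mul_fin_three`, `pair_identity_adjugate_fin_three` — the hypothesis-free forms of T1 with `adj M` for `M⁻¹`;
* `inv_eq_fin_three_of_det_eq_one`, `trace_inv_mul_fin_three_of_det_eq_one`, `pair_identity_fin_three_of_det_eq_one` —
  the `det M = 1` forms (`M⁻¹ = adj M`), i.e. T1 as used on `SL₃` / `SU(3)`;
* `su_three_pair_identity` — for `U ∈ SU(3)`: `conj(tr U) · tr W = tr (U† W) + tr U · tr (U W) − tr (U² W)`.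
Deliberately NOT here: anything about expectations, loop variables or certificates (the rows these identities generate are
exact linear relations among loop variables; whether they tighten a window is a separate, numerical question).
-/

namespace Summit.QuantumFields.GaugeBoot

open scoped Matrix

section CommRing

variable {R : Type*} [CommRing R]

/-- **Cayley–Hamilton, adjugate form**: for every `3 × 3` matrix over a commutative ring,
`adj M = M² − (tr M)·M + symm₂(M)·1`. [folklore] -/
theorem adjugate_fin_three_eq (M : Matrix (Fin 3) (Fin 3) R) :
    Matrix.adjugate M = M ^ 2 - M.trace • M + symm₂ M • (1 : Matrix (Fin 3) (Fin 3) R) := by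
  ext i j
  rw [Matrix.adjugate_fin_three]
  fin_cases i <;> fin_cases j <;>
    simp [pow_two, Matrix.mul_apply, Fin.sum_univ_three, symm₂, Matrix.trace] <;> ring

/-- `tr (adj M · W) = tr (M² W) − tr M · tr (M W) + symm₂ M · tr W` for `3 × 3` matrices. [folklore] -/
theorem trace_adjugate_mul_fin_three (M W : Matrix (Fin 3) (Fin 3) R) :
    (Matrix.adjugate M * W).trace = (M ^ 2 * W).trace - M.trace * (M * W).trace + symm₂ M * W.trace := by
  rw [adjugate_fin_three_eq, Matrix.add_mul, Matrix.sub_mul, Matrix.smul_mul, Matrix.smul_mul, Matrix.one_mul,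
    Matrix.trace_add, Matrix.trace_sub, Matrix.trace_smul, Matrix.trace_smul, smul_eq_mul, smul_eq_mul]

/-- **Pair identity T1, hypothesis-free form**: `tr (adj M) · tr W = tr (adj M · W) + tr M · tr (M W) − tr (M² W)`
for all `3 × 3` matrices `M`, `W` over a commutative ring. [folklore] -/
theorem pair_identity_adjugate_fin_three (M W : Matrix (Fin 3) (Fin 3) R) :
    (Matrix.adjugate M).trace * W.trace =
      (Matrix.adjugate M * W).trace + M.trace * (M * W).trace - (M ^ 2 * W).trace := by
  rw [trace_adjugate_mul_fin_three, trace_adjugate_fin_three]; ring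

/-- **`M⁻¹ = M² − (tr M)·M + symm₂(M)·1` when `det M = 1`** (`M⁻¹ = adj M`). [folklore] -/
theorem inv_eq_fin_three_of_det_eq_one (M : Matrix (Fin 3) (Fin 3) R) (h : M.det = 1) :
    M⁻¹ = M ^ 2 - M.trace • M + symm₂ M • (1 : Matrix (Fin 3) (Fin 3) R) := by
  rw [Matrix.inv_def, h, Ring.inverse_one, one_smul, adjugate_fin_three_eq]

/-- `det M = 1 ⟹ tr (M⁻¹ W) = tr (M² W) − tr M · tr (M W) + tr M⁻¹ · tr W` (`3 × 3`). [folklore] -/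
theorem trace_inv_mul_fin_three_of_det_eq_one (M W : Matrix (Fin 3) (Fin 3) R) (h : M.det = 1) :
    (M⁻¹ * W).trace = (M ^ 2 * W).trace - M.trace * (M * W).trace + (M⁻¹).trace * W.trace := by
  rw [trace_inv_fin_three_of_det_eq_one M h, Matrix.inv_def, h, Ring.inverse_one, one_smul,
    trace_adjugate_mul_fin_three]

/-- **Pair identity T1** (`SL₃` form): for a `3 × 3` matrix with `det M = 1` and any `W`,
`tr M⁻¹ · tr W = tr (M⁻¹ W) + tr M · tr (M W) − tr (M² W)`.  Its instances with `M`, `W` holonomies of based loops are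
the derived `SU(3)` equality rows of the kinematical audit (G1 `kin_su3audit_g1 --t1-out`, G2 `t1_tier_g2`). [folklore] -/
theorem pair_identity_fin_three_of_det_eq_one (M W : Matrix (Fin 3) (Fin 3) R) (h : M.det = 1) :
    (M⁻¹).trace * W.trace = (M⁻¹ * W).trace + M.trace * (M * W).trace - (M ^ 2 * W).trace := by
  rw [trace_inv_mul_fin_three_of_det_eq_one M W h]; ring

/-- The `W = M` instance of T1 ("modulus" identity): `det M = 1 ⟹ tr M⁻¹ · tr M = 3 + tr M · tr (M²) − tr (M³)`. [folklore] -/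
theorem trace_inv_mul_trace_fin_three_of_det_eq_one (M : Matrix (Fin 3) (Fin 3) R) (h : M.det = 1) :
    (M⁻¹).trace * M.trace = 3 + M.trace * (M ^ 2).trace - (M ^ 3).trace := by
  rw [pair_identity_fin_three_of_det_eq_one M M h, Matrix.nonsing_inv_mul M (by rw [h]; exact isUnit_one),
    Matrix.trace_one, Fintype.card_fin, pow_two, pow_succ, pow_two]
  push_cast; ring

end CommRing

section SU3

/-- **`SU(3)` pair identity**: for `U ∈ SU(3)` and any `3 × 3` complex matrix `W`,
`conj(tr U) · tr W = tr (U† W) + tr U · tr (U W) − tr (U² W)` (`U† = U⁻¹`, so this is T1). [folklore] -/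
theorem su_three_pair_identity (g : Matrix.specialUnitaryGroup (Fin 3) ℂ) (W : Matrix (Fin 3) (Fin 3) ℂ) :
    star (g : Matrix (Fin 3) (Fin 3) ℂ).trace * W.trace =
      (star (g : Matrix (Fin 3) (Fin 3) ℂ) * W).trace + (g : Matrix (Fin 3) (Fin 3) ℂ).trace *
        ((g : Matrix (Fin 3) (Fin 3) ℂ) * W).trace - ((g : Matrix (Fin 3) (Fin 3) ℂ) ^ 2 * W).trace := by
  have hU : (g : Matrix (Fin 3) (Fin 3) ℂ) ∈ Matrix.unitaryGroup (Fin 3) ℂ := g.2.1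
  have hdet : (g : Matrix (Fin 3) (Fin 3) ℂ).det = 1 := g.2.2
  have hinv : (g : Matrix (Fin 3) (Fin 3) ℂ)⁻¹ = star (g : Matrix (Fin 3) (Fin 3) ℂ) :=
    Matrix.inv_eq_left_inv (Matrix.mem_unitaryGroup_iff'.1 hU)
  have hs : star (g : Matrix (Fin 3) (Fin 3) ℂ).trace = ((g : Matrix (Fin 3) (Fin 3) ℂ)⁻¹).trace := by
    rw [hinv, Matrix.star_eq_conjTranspose, Matrix.trace_conjTranspose]
  rw [hs, ← hinv, pair_identity_fin_three_of_det_eq_one _ W hdet]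

end SU3

end Summit.QuantumFields.GaugeBoot
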